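import Literature.MathematicalPhysics.QuantumFieldTheory.Balaban1983to89.B9B8KnitTorusSocketAllLevels
import Literature.MathematicalPhysics.QuantumFieldTheory.Balaban1983to89.B8Thm2TorusMemberWeighted

/-!
# `Balaban1983to89.B9B8KnitTorusSocketCatalogued` — T. Bałaban, *Propagators and renormalization transformations for lattice gauge theories. I*, Commun.
# Math. Phys. **95** (1984) 17–40 [Balaban1985RegularSpaces], Thm 2 p. 83, (1.58)–(1.60) pp. 86–87, Prop. 3 p. 87, p. 77 («Ω_j = T_η»); *… II*, CMP **96**
# (1984) 223–250 [Balaban1984PropagatorsII], (2.1)–(2.4) p. 224, (2.16) p. 225 (the sequence of block lattices and its weights); *Propagators for lattice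
# gauge theories in a background field*, CMP **99** (1985) 389–434 [Balaban1985BackgroundPropagators], (3.16) p. 393, (3.41) p. 397, Thm 3.3 p. 399, (3.69)
# p. 404, Thm 3.11 p. 416: **THE [B8] THM 2 TORUS ASSEMBLER's (B)-ARROW HYPOTHESIS WITH THE MEMBER FAMILY SUPPLIED BY THE CATALOGUE** — the (B)-line
# bond junction, file F10 (over F9 `B9B8KnitTorusSocketAllLevels` and t2s-1 g7's `B8Thm2TorusMemberWeighted`).

statement-level skeleton of published theorems with citation tags; proofs where landed; nothing here is a claim about the Yang–Mills mass gap

THE POINT.  F9 delivers A17's hypothesis `∀ m′ ≤ K′, SockB9P3Per P₀ L B* C* c_P 0 len η m′ {ℤ^{d+1}} torusLam torusLamb` from a DISPLAYED member family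
`mem m′` of the shape of record.  The shape of record is exactly what t2s-1 g7's weighted constant-level catalogue
`B8Thm2TorusMemberWeighted.exists_constLev_member_weight` produces at band `b₀ = b₁ = 1` (`i.m = m + K`, `i.K = 0`, `i.k = m′ + 1`, `c_f = L^{m′+1}`,
`D.lev ≡ m′`, `w ι = c_f²·1·(L^{lev ι})^{d+1}·(L^{−lev ι})²`), for every `1 ≤ m′` with the catalogue's volume slack `m′ + a + 3 ≤ m + K` (`L^a ≥ 8`) — and the
socket `SockB9P3Per` mentions no member.  So THIS FILE chooses the members inside the proof and displays the Δ_a-side members (1)–(6) as a property of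
ALL shape-members `i : KIdx d ℓ hd hL 1 1` at levels `1 ≤ m′ ≤ K′` (the form in which the G-B9-LETTERS road proves them: generically in the member), the
windows on `a_T` and F7's numeric condition: ★★★ `sockB9P3Per_torus_allLevels_catalogued`, for the torus `PV d ℓ m K` (`P₀ = 2L^{m+K}`) and every
`K′ + a + 3 ≤ m + K`.

WHAT THIS FILE PROVES (one `theorem`; 0 `def`, 0 new named facts, 0 `sorry`; standard axioms; fibre `M_N(ℂ)`, `τ = tr`): ★★★
`sockB9P3Per_torus_allLevels_catalogued`.

HONEST FRAMING.  Packaging: F9 + the catalogue BY NAME (`choose`); the Δ_a-side members REMAIN DISPLAYED (now member-generic), as do the windows and the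
numeric condition; the band `b₀ = b₁ = 1` is forced by the identification of def-Y's weights `a` with print's (3.16) in F4's `ε_Q` (the weights of record
carry no band factor); nothing of A17's, the catalogue's, pub-ymgap's or the lane's files is modified; `stub_PV3A` NOT discharged; counts unmoved; one finite 𝕋⁴
programme at fixed ε, Bałaban AS PRINTED; the YM mass gap (Clay) is NOT proved by any of this — nothing continuum ∕ ℝ⁴ ∕ OS.  Cell `lit-balaban`, seat
t2s-1 g8 («B8 §3 Thm 2 TORUS SUPPLIER», (B)-line bond junction); `--supports stmt-QuantumFields-19200`.

References: T. Bałaban, CMP 95 (1984) 17–40 [Balaban1985RegularSpaces] Thm 2 p.83, p.77, (1.58)–(1.60) pp.86–87, Prop. 3 p.87; CMP 96 (1984) 223–250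
[Balaban1984PropagatorsII] (2.1)–(2.4) p.224, (2.16) p.225; CMP 99 (1985) 389–434 [Balaban1985BackgroundPropagators] (3.16) p.393, (3.41) p.397, Thm 3.3
p.399, (3.69) p.404, Thm 3.11 p.416.
-/

noncomputable section

namespace Literature.MathematicalPhysics.QuantumFieldTheory.Balaban1983to89.B9B8KnitTorusSocketCatalogued

open scoped BigOperators
open Node00
open B7Prop1Explicit renaming Site → LSite
open B7Prop2Explicit (unitaryUnits C0 c2')
open B6KLevelCensusIndexV1 (KIdx)
open B6GlobalChartV1 (PV)
open B8Ineq132 (InAk)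
open B8LeafModelZd (ZdIdx)
open B8LeafModelZd3SockPer (SockB9P3Per)
open B8Thm4TorusAt (torusLam)
open B8Thm2TorusMember (torusLamb)
open B9B8AveragingJunction (parKnitY)
open B8Thm2TorusLettersPerOfKnit (bgY)
open B9SupplySockB9P3ZdLetters (OpsZd)
open B9Eq316AveragingTransposeZd (qQ betaTau alphaQ)
open B9B8KnitTorusSocketAllLevels (sockB9P3Per_torus_allLevels_of_deltaASide)
open B8Thm2TorusMemberWeighted (exists_constLev_member_weight)
open T4TermwiseTorus (IsPeriodic)

variable {d ℓ : ℕ} {hd : 1 ≤ d + 1} {hL : Odd (ℓ + 1) ∧ 1 < ℓ + 1}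

section Matrix

open scoped Matrix Matrix.Norms.L2Operator

variable {N : ℕ} [NeZero N]

/-- ★★★ **THE [B8] THM 2 TORUS ASSEMBLER's (B)-ARROW HYPOTHESIS, MEMBER FAMILY FROM THE CATALOGUE.**  For the torus `PV d ℓ m K` (period `P₀ = 2L^{m+K}`),
a truncation bound `K′` with the catalogue's volume slack `K′ + a + 3 ≤ m + K` (`L^a ≥ 8`), a threshold `a_T` in the windows and F7's member-uniform numeric
condition: IF the six Δ_a-side members (1)–(6) of file 8c's binder hold, with a uniform `B₀`, at EVERY k-level member `i` (band `b₀ = b₁ = 1`) of the shape of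
record at a level `1 ≤ m′ ≤ K′` (`i.k = m′ + 1`, constant level `m′`, `c_f = L^{m′+1}`, the weights of record `w ι = c_f²·(L^{lev ι})^{d+1}·(L^{−lev ι})²`, period
`P₀`) and every admissible background, THEN the socket holds at EVERY truncation `m′ ≤ K′` at F9's constant set — the members being supplied by t2s-1 g7's
weighted constant-level catalogue `B8Thm2TorusMemberWeighted.exists_constLev_member_weight` at `b₀ = b₁ = 1`.  After this file the (B)-arrow of A17
displays NO member data: only the Δ_a-side members as a property of ALL shape-members (the G-B9-LETTERS road's deliverable), the windows and the numeric
condition.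
[cite: Balaban1985RegularSpaces, Thm 2 p.83, (1.58)–(1.60) pp.86–87, Prop. 3 p.87, p.77 («Ω_j = T_η»); Balaban1984PropagatorsII, (2.1)–(2.4) p.224, (2.16) p.225; Balaban1985BackgroundPropagators, Thm 3.3 p.399, (3.16) p.393, (3.41) p.397, (3.69) p.404, Thm 3.11 p.416] -/
theorem sockB9P3Per_torus_allLevels_catalogued (hℓ : 4 ≤ ℓ) (hd2 : 2 ≤ d + 1) (hL1 : 1 ≤ ℓ + 1)
    (τ : Matrix (Fin N) (Fin N) ℂ →ₗ[ℂ] ℂ) (hτ : ∀ a, τ a = Matrix.trace a) (hτt : ∀ a b, τ (a * b) = τ (b * a))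
    {Cτ : ℝ} (hCτ : ∀ x y : Matrix (Fin N) (Fin N) ℂ, |(τ (star x * y)).re| ≤ Cτ * ‖x‖ * ‖y‖)
    {m K K' a : ℕ} (h8 : 8 ≤ (ℓ + 1) ^ a) (hK : K' + a + 3 ≤ m + K) {η : ℝ} (hη : 0 < η) {k : ℕ} (hk : 1 ≤ k)
    (ops₀ : ℝ → ZdIdx (d + 1) (ℓ + 1) → ℕ →
      (letI : CStarAlgebra (Matrix (Fin N) (Fin N) ℂ) := {}; OpsZd (d + 1) (Matrix (Fin N) (Fin N) ℂ)))
    {M : ℝ} (hM1 : 1 ≤ M) {B₀ aT : ℝ} (hB₀ : 0 < B₀) (haT : 0 < aT) (haTQ : aT ≤ alphaQ (d + 1) (ℓ + 1) / ((ℓ + 1 : ℕ) : ℝ) ^ 2)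
    (haT3 : C0 (d + 1) * aT ≤ 1 / 3) (haT2 : 2 * aT ≤ c2' (d + 1) (ℓ + 1))
    (hεB : 2 * ((48 * ((d : ℝ) + 1) + 14 * d * M + (32 * ((d : ℝ) + 2) ^ 2 +
        12 * ((d : ℝ) + 1) ^ 2 * (13344 * ((d : ℝ) + 1) * ((d : ℝ) + 2) ^ 2 * ((d : ℝ) + 5) * (((ℓ + 1 : ℕ) : ℝ)) ^ (d + 4)) *
          (Cτ * (letI : CStarAlgebra (Matrix (Fin N) (Fin N) ℂ) := {}; betaTau τ)))) * aT) * B₀ ≤ 1)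
    (hΔ : letI : CStarAlgebra (Matrix (Fin N) (Fin N) ℂ) := {}
      ∀ (i : KIdx d ℓ hd hL 1 1) (m' : ℕ), 1 ≤ m' → m' ≤ K' → i.k = m' + 1 → (∀ x, i.D.lev x = m') →
      i.cf = (((ℓ + 1 : ℕ) : ℝ)) ^ (m' + 1) →
      (∀ ι : IBondY i, i.w ι = i.cf ^ 2 * (((((ℓ + 1 : ℕ) : ℝ)) ^ (ι.1.1 : ℕ)) ^ (d + 1) * (1 / (((ℓ + 1 : ℕ) : ℝ)) ^ (ι.1.1 : ℕ)) ^ 2)) →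
      (PV d ℓ i.m i.K hd hL).sitesPerDir 0 = (PV d ℓ m K hd hL).sitesPerDir 0 →
      ∀ (α₀ : ℝ) (U₀ : LSite (d + 1) → Fin (d + 1) → (Matrix (Fin N) (Fin N) ℂ)ˣ),
      (∀ x κ, U₀ x κ ∈ B7Prop2Explicit.unitaryUnits (Matrix (Fin N) (Fin N) ℂ)) →
      IsPeriodic ((PV d ℓ m K hd hL).sitesPerDir 0) U₀ → 0 < α₀ → α₀ ≤ aT →
      InAk (ℓ + 1) m' η α₀ (fun _ => (Set.univ : Set (LSite (d + 1)))) U₀ →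
        IsUnit (deltaAY i (parKnitY i) (parBY i) (GpY i (parKnitY i)) (bgY i U₀)) ∧
        (∀ F, wNormBY i (-1) (GAY i (parKnitY i) (parBY i) (GpY i (parKnitY i)) (bgY i U₀) F) ≤ B₀ * wNormBY i (-3) F) ∧
        (∀ F ν, wNormBY i (-2) (cdB i (bgY i U₀) ν (GAY i (parKnitY i) (parBY i) (GpY i (parKnitY i)) (bgY i U₀) F)) ≤ B₀ * wNormBY i (-3) F) ∧
        (∀ F, wNormBY i (-3) (lapB i (bgY i U₀) (GAY i (parKnitY i) (parBY i) (GpY i (parKnitY i)) (bgY i U₀) F)) ≤ B₀ * wNormBY i (-3) F) ∧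
        IsUnit (deltaPrimeAY i (parKnitY i) (bgY i U₀)) ∧ IsUnit (XY i (parKnitY i) (GpY i (parKnitY i)) (bgY i U₀)))
    (len : LSite (d + 1) → ℝ) :
    letI : CStarAlgebra (Matrix (Fin N) (Fin N) ℂ) := {}
    ∀ m', m' ≤ K' →
      SockB9P3Per (𝔸 := Matrix (Fin N) (Fin N) ℂ) ((PV d ℓ m K hd hL).sitesPerDir 0) (ℓ + 1)
        (max (max 1 (2 * (2 * B₀) * max 1 (qQ (d + 1) (ℓ + 1) Cτ (betaTau τ) 0))) (max 2 (4 * ((d + 1 : ℕ) : ℝ))))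
        (max (2 * max 0 (2 * (2 * B₀)) * max 1 (qQ (d + 1) (ℓ + 1) Cτ (betaTau τ) 0)) 4)
        (min (1 / 16) (min aT (min aT (1 / (2 * (2 * B₀) * (14 * ((d + 1 - 1 : ℕ) : ℝ)) * M + 1)))))
        0 len η m' (fun _ => (Set.univ : Set (LSite (d + 1)))) (fun m'' => torusLam (d := d + 1) m'') (fun m'' => torusLamb (d := d + 1) m'') := by
  classical
  letI : CStarAlgebra (Matrix (Fin N) (Fin N) ℂ) := {}
  -- the period of the torus, as a number
  have hP₀ : (PV d ℓ m K hd hL).sitesPerDir 0 = 2 * (ℓ + 1) ^ (m + K) := by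
    show 2 * (ℓ + 1) ^ (m + K - 0) = _; rw [Nat.sub_zero]
  -- the member family: t2s-1 g7's weighted constant-level catalogue at `b₀ = b₁ = 1`
  have hall : ∀ m' : ℕ, ∃ i : KIdx d ℓ hd hL 1 1, 1 ≤ m' → m' ≤ K' →
      (∀ x, i.D.lev x = m') ∧ i.k = m' + 1 ∧ (∀ z : SiteY i, levY i z = m') ∧
      (∀ ι : IBondY i, i.w ι = i.cf ^ 2 * (((((ℓ + 1 : ℕ) : ℝ)) ^ (ι.1.1 : ℕ)) ^ (d + 1) * (1 / (((ℓ + 1 : ℕ) : ℝ)) ^ (ι.1.1 : ℕ)) ^ 2)) ∧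
      i.cf = (((ℓ + 1 : ℕ) : ℝ)) ^ (m' + 1) ∧ (PV d ℓ i.m i.K hd hL).sitesPerDir 0 = (PV d ℓ m K hd hL).sitesPerDir 0 := by
    intro m'
    by_cases h : 1 ≤ m' ∧ m' ≤ K'
    · obtain ⟨i, him, hiK, hik, -, hicf, hiD, -, hiw⟩ :=
        exists_constLev_member_weight (d := d) (hd := hd) (hL := hL) (b₀ := (1 : ℝ)) (b₁ := (1 : ℝ)) hℓ one_pos le_rfl
          (T := m + K) (n := m') (a := a) (s := m + K - (m' + a + 2)) h.1 h8 (by omega) (by omega)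
      refine ⟨i, fun _ _ => ⟨hiD, hik, fun z => hiD z.1, fun ι => by rw [hiw, one_mul], by rw [hicf, hik], ?_⟩⟩
      rw [hP₀]
      show 2 * (ℓ + 1) ^ (i.m + i.K - 0) = _
      simp only [him, hiK, Nat.sub_zero, Nat.add_zero]
    · obtain ⟨i, -⟩ :=
        exists_constLev_member_weight (d := d) (hd := hd) (hL := hL) (b₀ := (1 : ℝ)) (b₁ := (1 : ℝ)) hℓ one_pos le_rfl
          (T := 1 + 1 + a + 1 + 1) (n := 1) (a := a) (s := 1) le_rfl h8 le_rfl rfl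
      exact ⟨i, fun h1 h2 => (h ⟨h1, h2⟩).elim⟩
  choose mem hmem using hall
  have hdvd : (ℓ + 1) ^ K' ∣ (PV d ℓ m K hd hL).sitesPerDir 0 := by
    rw [hP₀]; exact Dvd.dvd.mul_left (Nat.pow_dvd_pow _ (by omega)) 2
  exact sockB9P3Per_torus_allLevels_of_deltaASide hd2 hL1 τ hτ hτt hCτ hdvd hη hk mem (fun m' h1 h2 => hmem m' h1 h2) ops₀ hM1 hB₀ haT
    haTQ haT3 haT2 hεB
    (fun m' h1 h2 α₀ U₀ hU₀ hper hα₀ hα₀T hAk =>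
      hΔ (mem m') m' h1 h2 (hmem m' h1 h2).2.1 (hmem m' h1 h2).1 (hmem m' h1 h2).2.2.2.2.1 (hmem m' h1 h2).2.2.2.1 (hmem m' h1 h2).2.2.2.2.2
        α₀ U₀ hU₀ hper hα₀ hα₀T hAk) len

end Matrix

end Literature.MathematicalPhysics.QuantumFieldTheory.Balaban1983to89.B9B8KnitTorusSocketCatalogued
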